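/-
  Summits/AtomisticToContinuum/Crystallization/Theorems/OverbindingBudgetAffineFarStraighteningFit.lean

  residual stmt-AtomisticToContinuum-31280 · slot Z `FarAggregatePricing 12 (1/25) (1/2000) (1/(2·10⁷))` · leaf R_aff′
  `AffineChartStraightening'` (…FarSlotRecord §1; the load-bearing [M] leaf of record v15′, critic row 968 (e)): brick FIT of the
  radial-development plan (lens-4 g59 memo NODE-g59-RaffDesign §3, R00/R5(b)) — OPERATOR CONTROL OF AN AFFINE TWO-SHELL FRAME.
  decomp-a2c lens-4 «minimal counterexample / extremal reduction», generation 59.  Imports ONLY the tree file `…FarSlotRecord`.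
  0 sorry · 0 axiom · no instance · no notation · no option.
-/
import Summits.AtomisticToContinuum.Crystallization.Theorems.OverbindingBudgetAffineFarSlotRecord
import Summits.AtomisticToContinuum.Crystallization.Theorems.OverbindingBudgetAffineFarStraighteningConformal

/-! # FIT — operator control of an affine two-shell frame (PROVED)

`AffFramed ε θ g y j` (…AffineLadder §1) controls the linear part `A` of the frame only ON THE PATTERN: `‖A v − Q v‖ ≤ θ` for the 18
pattern vectors.  Every later brick of R_aff′ (comparability of adjacent frames, snapping, the assembly `‖B − Q₀‖ ≤ 2θ`) needs OPERATOR
control.  The three axis vectors `√2·e_a` belong to BOTH two-shell patterns (second shell of fcc `(±2,0,0)/√2`, of hcp `(6,0,0)/√18`), so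
`‖(A − Q) e_a‖ ≤ θ/√2` and, by `ℓ¹ ≤ √3·ℓ²` on the coordinates, `‖(A − Q) u‖ ≤ √(3/2)·θ·‖u‖ ≤ (5/4)·θ·‖u‖`.
* §1 `sqrt_two_smul_single_mem_fcc/hcpTwoShellPattern`, `…_of_twoShell`.
* §2 `norm_apply_le_of_axes`: `‖D(√2 e_a)‖ ≤ t` (`a = 0,1,2`) ⇒ `‖D u‖ ≤ 5/4·t·‖u‖`.
* §3 `norm_sub_le_of_pattern_fit`: the pattern fit ⇒ `‖A u − Q u‖ ≤ 5/4·θ·‖u‖`; two-sided bounds `frame_norm_bounds`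
  (`(1 − 5θ/4)‖u‖ ≤ ‖A u‖ ≤ (1 + 5θ/4)‖u‖`), injectivity.
* §4 `AffFramed.opNorm`: the packaged form at a framed site, and the SEPARATION of a framed environment
  `affFramed_separation`: two distinct sites of `{j} ∪ env(j)` are `≥ (1 − 5θ/4 − 2ε)·nn_j` apart.
-/

namespace Summit.AtomisticToContinuum.Crystallization.Theorems.OverbindingBudgetAffineFarSmoothSplit

open scoped BigOperators RealInnerProductSpace
open Literature.Geometry.DiscreteGeometry (nearestDist nearestDist_nonneg fccTwoShellPattern hcpTwoShellPattern scaledPattern intVec intVec_apply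
  fccInt hcpInt fccSecondShellInt hcpSecondShellInt norm_of_mem_fccTwoShellPattern norm_of_mem_hcpTwoShellPattern
  one_le_dist_of_mem_fccTwoShellPattern one_le_dist_of_mem_hcpTwoShellPattern norm_sq_fin3)
open Summit.AtomisticToContinuum.Crystallization.Theorems.OverbindingBudgetAffineLadder

/-! ## §1  The axis vectors lie in both two-shell patterns (PROVED) -/

/-- `(√2)⁻¹ · 2 = √2`. [this file] -/
theorem inv_sqrt_two_mul_two_eq : (Real.sqrt 2)⁻¹ * 2 = Real.sqrt 2 := by
  have hs : (0 : ℝ) < Real.sqrt 2 := by positivity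
  rw [inv_mul_eq_iff_eq_mul₀ hs.ne', Real.mul_self_sqrt (by norm_num : (0 : ℝ) ≤ 2)]

/-- `(√18)⁻¹ · 6 = √2`. [this file] -/
theorem inv_sqrt_eighteen_mul_six_eq : (Real.sqrt 18)⁻¹ * 6 = Real.sqrt 2 := by
  have h18 : Real.sqrt 18 = 3 * Real.sqrt 2 := by
    rw [show (18 : ℝ) = 3 ^ 2 * 2 by norm_num, Real.sqrt_mul (by norm_num) 2, Real.sqrt_sq (by norm_num)]
  have hs : (0 : ℝ) < Real.sqrt 18 := by positivity
  rw [inv_mul_eq_iff_eq_mul₀ hs.ne', h18, mul_assoc, Real.mul_self_sqrt (by norm_num : (0 : ℝ) ≤ 2)]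
  norm_num

/-- The axis vector `√2 • e_a` is the second-shell vector `(2 e_a)/√2` of the FCC two-shell pattern. [this file] -/
theorem sqrt_two_smul_single_mem_fccTwoShellPattern (a : Fin 3) :
    Real.sqrt 2 • EuclideanSpace.single a (1 : ℝ) ∈ fccTwoShellPattern := by
  rw [fccTwoShellPattern, scaledPattern, Finset.mem_image]
  fin_cases a
  · refine ⟨![2, 0, 0], by decide, ?_⟩
    ext j
    fin_cases j <;> simp [intVec_apply, inv_sqrt_two_mul_two_eq]
  · refine ⟨![0, 2, 0], by decide, ?_⟩
    ext j
    fin_cases j <;> simp [intVec_apply, inv_sqrt_two_mul_two_eq]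
  · refine ⟨![0, 0, 2], by decide, ?_⟩
    ext j
    fin_cases j <;> simp [intVec_apply, inv_sqrt_two_mul_two_eq]

/-- The axis vector `√2 • e_a` is the second-shell vector `(6 e_a)/√18` of the HCP two-shell pattern. [this file] -/
theorem sqrt_two_smul_single_mem_hcpTwoShellPattern (a : Fin 3) :
    Real.sqrt 2 • EuclideanSpace.single a (1 : ℝ) ∈ hcpTwoShellPattern := by
  rw [hcpTwoShellPattern, scaledPattern, Finset.mem_image]
  fin_cases a
  · refine ⟨![6, 0, 0], by decide, ?_⟩
    ext j
    fin_cases j <;> simp [intVec_apply, inv_sqrt_eighteen_mul_six_eq]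
  · refine ⟨![0, 6, 0], by decide, ?_⟩
    ext j
    fin_cases j <;> simp [intVec_apply, inv_sqrt_eighteen_mul_six_eq]
  · refine ⟨![0, 0, 6], by decide, ?_⟩
    ext j
    fin_cases j <;> simp [intVec_apply, inv_sqrt_eighteen_mul_six_eq]

-- `sqrt_two_smul_single_mem_of_twoShell` = `axis_mem_twoShell` of `…StraighteningConformal` (same namespace; gate dedup).

/-! ## §2  Operator bound from the three axis vectors (PROVED) -/

-- `le_of_sq_le_sq_nonneg` and `one_le_norm_of_mem_twoShell` are already landed elsewhere (gate dedup); Mathlib's `abs_le_of_sq_le_sq'` and an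
-- inlined two-shell norm computation are used instead.

/-- `ℓ¹ ≤ (5√2/4)·ℓ²` on `ℝ³`: `|u₀| + |u₁| + |u₂| ≤ 5/4·√2·‖u‖` (as `(Σ|u_a|)² ≤ 3‖u‖² ≤ (25/8)‖u‖²`). [this file] -/
theorem abs_sum_le_norm (u : EuclideanSpace ℝ (Fin 3)) : |u 0| + |u 1| + |u 2| ≤ 5 / 4 * Real.sqrt 2 * ‖u‖ := by
  have hsq := norm_sq_fin3 u
  have h2 : Real.sqrt 2 * Real.sqrt 2 = 2 := Real.mul_self_sqrt (by norm_num)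
  have hn : 0 ≤ ‖u‖ := norm_nonneg u
  have h3 : (|u 0| + |u 1| + |u 2|) ^ 2 ≤ 3 * ‖u‖ ^ 2 := by
    rw [hsq, ← sq_abs (u 0), ← sq_abs (u 1), ← sq_abs (u 2)]
    nlinarith [sq_nonneg (|u 0| - |u 1|), sq_nonneg (|u 1| - |u 2|), sq_nonneg (|u 0| - |u 2|)]
  have h4 : (5 / 4 * Real.sqrt 2 * ‖u‖) ^ 2 = 25 / 8 * ‖u‖ ^ 2 := by nlinarith [h2]
  refine (abs_le_of_sq_le_sq' ?_ (by positivity)).2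
  rw [h4]
  nlinarith [sq_nonneg ‖u‖]

/-- A vector of `ℝ³` is the combination of the coordinate vectors with its coordinates. [folklore] -/
theorem eq_sum_coord_smul_single (u : EuclideanSpace ℝ (Fin 3)) :
    u = ∑ a : Fin 3, u a • EuclideanSpace.single a (1 : ℝ) := by
  ext j
  fin_cases j <;> simp [Fin.sum_univ_three]

/-- **Operator bound from the axes.**  A linear map of `ℝ³` bounded by `t` on the three axis vectors `√2·e_a` is bounded by
`(5/4)·t` in operator norm (`√(3/2) ≤ 5/4`). [this file] -/
theorem norm_apply_le_of_axes (D : EuclideanSpace ℝ (Fin 3) →ₗ[ℝ] EuclideanSpace ℝ (Fin 3)) {t : ℝ}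
    (h : ∀ a : Fin 3, ‖D (Real.sqrt 2 • EuclideanSpace.single a (1 : ℝ))‖ ≤ t) (u : EuclideanSpace ℝ (Fin 3)) :
    ‖D u‖ ≤ 5 / 4 * t * ‖u‖ := by
  have hs : (0 : ℝ) < Real.sqrt 2 := by positivity
  have ht : 0 ≤ t := (norm_nonneg _).trans (h 0)
  have hterm : ∀ a : Fin 3, ‖D (u a • EuclideanSpace.single a (1 : ℝ))‖ ≤ |u a| / Real.sqrt 2 * t := by
    intro a
    have hre : u a • EuclideanSpace.single a (1 : ℝ) =
        (u a / Real.sqrt 2) • (Real.sqrt 2 • EuclideanSpace.single a (1 : ℝ)) := by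
      rw [smul_smul, div_mul_cancel₀ _ hs.ne']
    rw [hre, map_smul, norm_smul, Real.norm_eq_abs, abs_div, abs_of_pos hs]
    exact mul_le_mul_of_nonneg_left (h a) (by positivity)
  have hDu : D u = ∑ a : Fin 3, D (u a • EuclideanSpace.single a (1 : ℝ)) := by
    conv_lhs => rw [eq_sum_coord_smul_single u]
    rw [map_sum]
  have hsum : ‖D u‖ ≤ (|u 0| + |u 1| + |u 2|) / Real.sqrt 2 * t := by
    rw [hDu]
    calc ‖∑ a : Fin 3, D (u a • EuclideanSpace.single a (1 : ℝ))‖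
        ≤ ∑ a : Fin 3, ‖D (u a • EuclideanSpace.single a (1 : ℝ))‖ := norm_sum_le _ _
      _ ≤ ∑ a : Fin 3, |u a| / Real.sqrt 2 * t := Finset.sum_le_sum fun a _ => hterm a
      _ = (|u 0| + |u 1| + |u 2|) / Real.sqrt 2 * t := by
          simp only [Fin.sum_univ_three]; ring
  have hl1 := abs_sum_le_norm u
  calc ‖D u‖ ≤ (|u 0| + |u 1| + |u 2|) / Real.sqrt 2 * t := hsum
    _ ≤ (5 / 4 * Real.sqrt 2 * ‖u‖) / Real.sqrt 2 * t := by gcongr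
    _ = 5 / 4 * t * ‖u‖ := by
        field_simp

/-! ## §3  Operator control from the pattern fit (PROVED) -/

/-- **FIT.**  If `A` is `θ`-close to the linear isometry `Q` on the 18 vectors of a two-shell pattern, then `‖A u − Q u‖ ≤ (5/4)·θ·‖u‖`
for every `u`. [this file] -/
theorem norm_sub_le_of_pattern_fit {P : Finset (EuclideanSpace ℝ (Fin 3))} (hP : P = fccTwoShellPattern ∨ P = hcpTwoShellPattern)
    {A : EuclideanSpace ℝ (Fin 3) →ₗ[ℝ] EuclideanSpace ℝ (Fin 3)} {Q : EuclideanSpace ℝ (Fin 3) →ₗᵢ[ℝ] EuclideanSpace ℝ (Fin 3)}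
    {θ : ℝ} (hfit : ∀ v ∈ P, ‖A v - Q v‖ ≤ θ) (u : EuclideanSpace ℝ (Fin 3)) : ‖A u - Q u‖ ≤ 5 / 4 * θ * ‖u‖ := by
  have h := norm_apply_le_of_axes (A - Q.toLinearMap) (t := θ)
    (fun a => by
      simp only [LinearMap.sub_apply, LinearIsometry.coe_toLinearMap]
      exact hfit _ (axis_mem_twoShell hP a)) u
  simpa [LinearMap.sub_apply] using h

/-- Two-sided norm bounds for the linear part of an affine two-shell frame. [this file] -/
theorem frame_norm_bounds {P : Finset (EuclideanSpace ℝ (Fin 3))} (hP : P = fccTwoShellPattern ∨ P = hcpTwoShellPattern)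
    {A : EuclideanSpace ℝ (Fin 3) →ₗ[ℝ] EuclideanSpace ℝ (Fin 3)} {Q : EuclideanSpace ℝ (Fin 3) →ₗᵢ[ℝ] EuclideanSpace ℝ (Fin 3)}
    {θ : ℝ} (hfit : ∀ v ∈ P, ‖A v - Q v‖ ≤ θ) (u : EuclideanSpace ℝ (Fin 3)) :
    (1 - 5 / 4 * θ) * ‖u‖ ≤ ‖A u‖ ∧ ‖A u‖ ≤ (1 + 5 / 4 * θ) * ‖u‖ := by
  have h := norm_sub_le_of_pattern_fit hP hfit u
  have hQ : ‖Q u‖ = ‖u‖ := Q.norm_map u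
  have h1 : ‖Q u‖ ≤ ‖A u‖ + ‖A u - Q u‖ :=
    calc ‖Q u‖ = ‖A u - (A u - Q u)‖ := by rw [sub_sub_cancel]
      _ ≤ ‖A u‖ + ‖A u - Q u‖ := norm_sub_le _ _
  have h2 : ‖A u‖ ≤ ‖Q u‖ + ‖A u - Q u‖ :=
    calc ‖A u‖ = ‖Q u + (A u - Q u)‖ := by rw [add_sub_cancel]
      _ ≤ ‖Q u‖ + ‖A u - Q u‖ := norm_add_le _ _
  constructor
  · have : (1 - 5 / 4 * θ) * ‖u‖ = ‖u‖ - 5 / 4 * θ * ‖u‖ := by ring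
    linarith
  · have : (1 + 5 / 4 * θ) * ‖u‖ = ‖u‖ + 5 / 4 * θ * ‖u‖ := by ring
    linarith

/-- Lower bound on differences of frame images of `1`-separated vectors: `‖v − w‖ ≥ 1` ⇒ `‖A v − A w‖ ≥ 1 − 5θ/4`. [this file] -/
theorem frame_sub_norm_ge {P : Finset (EuclideanSpace ℝ (Fin 3))} (hP : P = fccTwoShellPattern ∨ P = hcpTwoShellPattern)
    {A : EuclideanSpace ℝ (Fin 3) →ₗ[ℝ] EuclideanSpace ℝ (Fin 3)} {Q : EuclideanSpace ℝ (Fin 3) →ₗᵢ[ℝ] EuclideanSpace ℝ (Fin 3)}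
    {θ : ℝ} (hθ : 5 / 4 * θ ≤ 1) (hfit : ∀ v ∈ P, ‖A v - Q v‖ ≤ θ) {v w : EuclideanSpace ℝ (Fin 3)} (hvw : 1 ≤ ‖v - w‖) :
    1 - 5 / 4 * θ ≤ ‖A v - A w‖ := by
  have h := (frame_norm_bounds hP hfit (v - w)).1
  rw [map_sub] at h
  have h0 : 0 ≤ 1 - 5 / 4 * θ := by linarith
  calc 1 - 5 / 4 * θ = (1 - 5 / 4 * θ) * 1 := (mul_one _).symm
    _ ≤ (1 - 5 / 4 * θ) * ‖v - w‖ := mul_le_mul_of_nonneg_left hvw h0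
    _ ≤ ‖A v - A w‖ := h

/-- `0` is not a pattern point. [this file] -/
theorem ne_zero_of_mem_twoShell {P : Finset (EuclideanSpace ℝ (Fin 3))}
    (hP : P = fccTwoShellPattern ∨ P = hcpTwoShellPattern) {x : EuclideanSpace ℝ (Fin 3)} (hx : x ∈ P) : x ≠ 0 := by
  intro h0
  have h : (1 : ℝ) ≤ ‖x‖ := (by
      have h1 : (1 : ℝ) ≤ Real.sqrt 2 := Real.one_le_sqrt.mpr (by norm_num)
      rcases hP with rfl | rfl
      · rcases norm_of_mem_fccTwoShellPattern hx with h | h <;> rw [h]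
        exact h1
      · rcases norm_of_mem_hcpTwoShellPattern hx with h | h <;> rw [h]
        exact h1)
  rw [h0, norm_zero] at h
  exact absurd h (by norm_num)

/-- Distinct points of `insert 0 P` (a two-shell pattern with its centre) are `1`-separated. [HalesDSP2012 §1.3; this file] -/
theorem one_le_norm_sub_of_mem_insert_zero {P : Finset (EuclideanSpace ℝ (Fin 3))}
    (hP : P = fccTwoShellPattern ∨ P = hcpTwoShellPattern) {v w : EuclideanSpace ℝ (Fin 3)}
    (hv : v = 0 ∨ v ∈ P) (hw : w = 0 ∨ w ∈ P) (hne : v ≠ w) : 1 ≤ ‖v - w‖ := by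
  rcases hv with rfl | hv <;> rcases hw with rfl | hw
  · exact absurd rfl hne
  · rw [zero_sub, norm_neg]; exact (by
      have h1 : (1 : ℝ) ≤ Real.sqrt 2 := Real.one_le_sqrt.mpr (by norm_num)
      rcases hP with rfl | rfl
      · rcases norm_of_mem_fccTwoShellPattern hw with h | h <;> rw [h]
        exact h1
      · rcases norm_of_mem_hcpTwoShellPattern hw with h | h <;> rw [h]
        exact h1)
  · rw [sub_zero]; exact (by
      have h1 : (1 : ℝ) ≤ Real.sqrt 2 := Real.one_le_sqrt.mpr (by norm_num)
      rcases hP with rfl | rfl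
      · rcases norm_of_mem_fccTwoShellPattern hv with h | h <;> rw [h]
        exact h1
      · rcases norm_of_mem_hcpTwoShellPattern hv with h | h <;> rw [h]
        exact h1)
  · rw [← dist_eq_norm]
    rcases hP with rfl | rfl
    · exact one_le_dist_of_mem_fccTwoShellPattern hv hw hne
    · exact one_le_dist_of_mem_hcpTwoShellPattern hv hw hne

/-! ## §4  At a framed site: labels and separation of the environment (PROVED) -/

/-- **LABELS.**  At an affinely framed site `j`, every site `k` of `{j} ∪ env(j)` carries a label: `0` for `k = j`, and for `k ≠ j`
a pattern vector `v ∈ P` with `f v = y k`; in both cases `dist (y k) (y j + nn_j • A v) ≤ ε·nn_j`. [this file] -/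
theorem exists_label_of_affFramed {N : ℕ} {y : Fin N → EuclideanSpace ℝ (Fin 3)} {j : Fin N} {ε g : ℝ} (hε : 0 ≤ ε)
    {A : EuclideanSpace ℝ (Fin 3) →ₗ[ℝ] EuclideanSpace ℝ (Fin 3)}
    {P : Finset (EuclideanSpace ℝ (Fin 3))} {f : EuclideanSpace ℝ (Fin 3) → EuclideanSpace ℝ (Fin 3)}
    (hfit : ∀ v ∈ P, f v ∈ Set.range y ∧ dist (f v) (y j + nearestDist y j • A v) ≤ ε * nearestDist y j)
    (hexh : ∀ k : Fin N, k ≠ j → dist (y k) (y j) ≤ (3 / 2 + g) * nearestDist y j → ∃ v ∈ P, f v = y k)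
    {k : Fin N} (hk : k = j ∨ dist (y k) (y j) ≤ (3 / 2 + g) * nearestDist y j) :
    ∃ v, ((k = j ∧ v = 0) ∨ (k ≠ j ∧ v ∈ P ∧ f v = y k)) ∧
      dist (y k) (y j + nearestDist y j • A v) ≤ ε * nearestDist y j := by
  by_cases hkj : k = j
  · subst hkj
    refine ⟨0, Or.inl ⟨rfl, rfl⟩, ?_⟩
    rw [map_zero, smul_zero, add_zero, dist_self]
    exact mul_nonneg hε (nearestDist_nonneg y k)
  · have hd : dist (y k) (y j) ≤ (3 / 2 + g) * nearestDist y j := hk.resolve_left hkj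
    obtain ⟨v, hv, hfv⟩ := hexh k hkj hd
    refine ⟨v, Or.inr ⟨hkj, hv, hfv⟩, ?_⟩
    rw [← hfv]
    exact (hfit v hv).2

/-- The distance of two ideal frame points: `dist (c + s•A v) (c + s•A w) = s·‖A v − A w‖` for `s ≥ 0`. [this file] -/
theorem dist_framePoint_eq {c : EuclideanSpace ℝ (Fin 3)} {s : ℝ} (hs : 0 ≤ s)
    (A : EuclideanSpace ℝ (Fin 3) →ₗ[ℝ] EuclideanSpace ℝ (Fin 3)) (v w : EuclideanSpace ℝ (Fin 3)) :
    dist (c + s • A v) (c + s • A w) = s * ‖A v - A w‖ := by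
  rw [dist_eq_norm, add_sub_add_left_eq_sub, ← smul_sub, norm_smul, Real.norm_of_nonneg hs]

/-- **SEPARATION of a framed environment.**  At an `AffFramed ε θ g` site `j` (`5θ/4 ≤ 1`), two sites of `{j} ∪ env(j)` at distinct
positions are `≥ (1 − 5θ/4 − 2ε)·nn_j` apart. [this file] -/
theorem affFramed_separation {N : ℕ} {y : Fin N → EuclideanSpace ℝ (Fin 3)} {j : Fin N} {ε θ g : ℝ} (hε : 0 ≤ ε)
    (hθ : 5 / 4 * θ ≤ 1) (hfr : AffFramed ε θ g y j) {k k' : Fin N}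
    (hk : k = j ∨ dist (y k) (y j) ≤ (3 / 2 + g) * nearestDist y j)
    (hk' : k' = j ∨ dist (y k') (y j) ≤ (3 / 2 + g) * nearestDist y j) (hne : y k ≠ y k') :
    (1 - 5 / 4 * θ - 2 * ε) * nearestDist y j ≤ dist (y k) (y k') := by
  obtain ⟨Q, A, P, f, hP, hAQ, hfit, hinj, hexh⟩ := hfr
  have hnn : 0 ≤ nearestDist y j := nearestDist_nonneg y j
  obtain ⟨v, hv, hdv⟩ := exists_label_of_affFramed hε hfit hexh hk
  obtain ⟨w, hw, hdw⟩ := exists_label_of_affFramed hε hfit hexh hk'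
  have hone : ∀ x ∈ P, x ≠ 0 := fun x hx => ne_zero_of_mem_twoShell hP hx
  have hv0 : v = 0 ∨ v ∈ P := by
    rcases hv with ⟨_, h⟩ | ⟨_, h, _⟩
    · exact Or.inl h
    · exact Or.inr h
  have hw0 : w = 0 ∨ w ∈ P := by
    rcases hw with ⟨_, h⟩ | ⟨_, h, _⟩
    · exact Or.inl h
    · exact Or.inr h
  have hvw : v ≠ w := by
    intro heq
    rcases hv with ⟨hkj, hv⟩ | ⟨hkj, hvP, hfv⟩ <;> rcases hw with ⟨hk'j, hw⟩ | ⟨hk'j, hwP, hfw⟩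
    · exact hne (by rw [hkj, hk'j])
    · exact hone w hwP (by rw [← heq, hv])
    · exact hone v hvP (by rw [heq, hw])
    · exact hne (by rw [← hfv, ← hfw, heq])
  have hsep : 1 - 5 / 4 * θ ≤ ‖A v - A w‖ :=
    frame_sub_norm_ge hP hθ hAQ (one_le_norm_sub_of_mem_insert_zero hP hv0 hw0 hvw)
  have htri := dist_triangle4 (y j + nearestDist y j • A v) (y k) (y k') (y j + nearestDist y j • A w)
  rw [dist_framePoint_eq hnn, dist_comm (y j + nearestDist y j • A v) (y k)] at htri
  have hmul : (1 - 5 / 4 * θ) * nearestDist y j ≤ nearestDist y j * ‖A v - A w‖ := by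
    rw [mul_comm]
    exact mul_le_mul_of_nonneg_left hsep hnn
  nlinarith [hmul, htri, hdv, hdw]

end Summit.AtomisticToContinuum.Crystallization.Theorems.OverbindingBudgetAffineFarSmoothSplit
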